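import Mathlib
import HarnessLib
import Literature.Analysis.Complex.PickFunctionsProofs

/-!
# Pick inversion, auxiliary file 3: the Poisson transform `F(z) = ∫ (1-t²)/(1-2tz+t²) dμ(t)`
# of a measure on `[0,1]` is a non-vanishing holomorphic function, and `-1/F` is a Pick function

Helper file for stub `stub_pickInversion` of line `self-energy-pick-inversion`, crux
`PrecisionLaplacian.DirectCorrelationStableTail` (stmt-CriticalPhenomena-4799). Pure theorem file.

For a finite positive measure `μ` on `[0, 1]` charging `[0, 1)`, the function
`F(z) = ∫ (1 - t²)/(1 - 2tz + t²) dμ(t)` (written inline) is holomorphic on the slit region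
`U = {Im z > 0} ∪ {Re z < 1}` (dominated holomorphic parameter integral,
`Literature.Analysis.Complex.differentiableOn_integral_of_dominated`), real on the real half-line
`(-∞, 1)`, nowhere zero on `U` (`Re F + K Im F > 0` for a suitable `K`), and has `Im F ≥ 0` on the
upper half-plane; hence `H = -1/F` is a Pick function (`isPickFunction_neg_inv_poissonTransform`,
registered sub-goal `stub_pickInversion_auxPick`), to which the tree's Nevanlinna representation
theorem `Literature.Analysis.Complex.nevanlinna_representation_holds` applies. On the circle,
`F(cos θ)/(2π)` is the Poisson mixture of the previous file. References: Donoghue,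
*Monotone matrix functions and analytic continuation* (1974), Ch. II; Rosenblum–Rovnyak (1985) App. §6.
-/

noncomputable section

namespace Summit.CriticalPhenomena.Ising3DConformalLimit.Cruxes.DirectCorrelationStableTail.SelfEnergyPickInversion

open MeasureTheory Filter Topology Set Real Complex Metric
open scoped BigOperators ComplexConjugate
open Literature.Analysis.Complex

/-! ### The denominator `1 - 2tz + t²` -/

/-- Real and imaginary parts of the denominator `1 - 2tz + t²` (`t` real). [folklore] -/
theorem poissonDen_re_im (t : ℝ) (z : ℂ) :
    (1 - 2 * (t : ℂ) * z + (t : ℂ) ^ 2).re = 1 - 2 * t * z.re + t ^ 2 ∧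
      (1 - 2 * (t : ℂ) * z + (t : ℂ) ^ 2).im = -(2 * t * z.im) := by
  constructor
  · simp [Complex.mul_re, pow_two]
  · simp [Complex.mul_im, pow_two]

/-- On the slit region `{Im z > 0} ∪ {Re z < 1}` the denominator `1 - 2tz + t²` does not vanish for
`t ∈ [0, 1]`. [folklore] -/
theorem poissonDen_ne_zero {t : ℝ} (ht : t ∈ Set.Icc (0 : ℝ) 1) {z : ℂ} (hz : 0 < z.im ∨ z.re < 1) :
    (1 - 2 * (t : ℂ) * z + (t : ℂ) ^ 2) ≠ 0 := by
  obtain ⟨hre, him⟩ := poissonDen_re_im t z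
  intro h
  have h1 := congrArg Complex.re h
  have h2 := congrArg Complex.im h
  rw [hre, Complex.zero_re] at h1
  rw [him, Complex.zero_im] at h2
  rcases hz with hz | hz
  · have ht0 : t = 0 := by nlinarith [ht.1]
    rw [ht0] at h1
    norm_num at h1
  · have h3 : 0 ≤ 2 * t * (1 - z.re) := mul_nonneg (mul_nonneg two_pos.le ht.1) (sub_pos.2 hz).le
    have h4 : (1 - t) ^ 2 = 0 := by nlinarith [sq_nonneg (1 - t)]
    have ht1 : t = 1 := by nlinarith [pow_eq_zero_iff (n := 2) (a := 1 - t) two_ne_zero |>.mp h4]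
    subst ht1
    linarith

/-- The slit region `{Im z > 0} ∪ {Re z < 1}` is open. [folklore] -/
theorem isOpen_slitRegion : IsOpen {z : ℂ | 0 < z.im ∨ z.re < 1} :=
  (isOpen_lt continuous_const Complex.continuous_im).union (isOpen_lt Complex.continuous_re continuous_const)

/-- **Uniform lower bound for the denominator** near a point of the slit region: there are `R > 0`
and `m > 0` with `ball z₀ R` inside the region and `m ≤ |1 - 2tz + t²|` for `t ∈ [0,1]`,
`z ∈ ball z₀ R` (compactness of `[0,1] × closedBall z₀ R`). [folklore] -/
theorem exists_poissonDen_lower_bound {z₀ : ℂ} (hz₀ : 0 < z₀.im ∨ z₀.re < 1) :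
    ∃ R m : ℝ, 0 < R ∧ 0 < m ∧ ball z₀ R ⊆ {z : ℂ | 0 < z.im ∨ z.re < 1} ∧
      ∀ t ∈ Set.Icc (0 : ℝ) 1, ∀ z ∈ ball z₀ R, m ≤ ‖1 - 2 * (t : ℂ) * z + (t : ℂ) ^ 2‖ := by
  obtain ⟨R₀, hR₀, hball⟩ := Metric.isOpen_iff.mp isOpen_slitRegion z₀ hz₀
  set R : ℝ := R₀ / 2 with hR
  have hRpos : 0 < R := by positivity
  have hcb : closedBall z₀ R ⊆ {z : ℂ | 0 < z.im ∨ z.re < 1} :=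
    (closedBall_subset_ball (by rw [hR]; linarith)).trans hball
  -- the continuous positive function `(t, z) ↦ |1 - 2tz + t²|` on the compact `[0,1] × closedBall`
  set K : Set (ℝ × ℂ) := Set.Icc (0 : ℝ) 1 ×ˢ closedBall z₀ R with hK
  have hKc : IsCompact K := isCompact_Icc.prod (isCompact_closedBall z₀ R)
  have hKne : K.Nonempty := ⟨(0, z₀), ⟨by norm_num, by norm_num⟩, mem_closedBall_self hRpos.le⟩
  have h1 : Continuous fun p : ℝ × ℂ => (p.1 : ℂ) := Complex.continuous_ofReal.comp continuous_fst
  have hcont : ContinuousOn (fun p : ℝ × ℂ => ‖1 - 2 * (p.1 : ℂ) * p.2 + (p.1 : ℂ) ^ 2‖) K :=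
    ((continuous_const.sub ((continuous_const.mul h1).mul continuous_snd)).add (h1.pow 2)).norm
      |>.continuousOn
  obtain ⟨p₀, hp₀K, hp₀⟩ := hKc.exists_isMinOn hKne hcont
  obtain ⟨t₀, w₀⟩ := p₀
  have hmpos : 0 < ‖1 - 2 * (t₀ : ℂ) * w₀ + (t₀ : ℂ) ^ 2‖ :=
    norm_pos_iff.mpr (poissonDen_ne_zero hp₀K.1 (hcb hp₀K.2))
  have hmle : ∀ t ∈ Set.Icc (0 : ℝ) 1, ∀ z ∈ ball z₀ R,
      ‖1 - 2 * (t₀ : ℂ) * w₀ + (t₀ : ℂ) ^ 2‖ ≤ ‖1 - 2 * (t : ℂ) * z + (t : ℂ) ^ 2‖ := by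
    intro t ht z hz
    have hmem : ((t, z) : ℝ × ℂ) ∈ K := ⟨ht, ball_subset_closedBall hz⟩
    exact (isMinOn_iff.mp hp₀) (t, z) hmem
  exact ⟨R, _, hRpos, hmpos, ball_subset_closedBall.trans hcb, hmle⟩

/-! ### The Poisson transform `F(z) = ∫ (1 - t²)/(1 - 2tz + t²) dμ(t)` -/

/-- Measurability of the integrand in `t`. [folklore] -/
theorem measurable_poissonIntegrand (z : ℂ) :
    Measurable fun t : ℝ => ((1 - t ^ 2 : ℝ) : ℂ) / (1 - 2 * (t : ℂ) * z + (t : ℂ) ^ 2) :=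
  (Complex.measurable_ofReal.comp (by fun_prop)).div (by fun_prop)

/-- The integrand is bounded by `1/m` when the denominator is at least `m` (`t ∈ [0,1]`). [folklore] -/
theorem norm_poissonIntegrand_le {t : ℝ} (ht : t ∈ Set.Icc (0 : ℝ) 1) {z : ℂ} {m : ℝ} (hm : 0 < m)
    (hmz : m ≤ ‖1 - 2 * (t : ℂ) * z + (t : ℂ) ^ 2‖) :
    ‖((1 - t ^ 2 : ℝ) : ℂ) / (1 - 2 * (t : ℂ) * z + (t : ℂ) ^ 2)‖ ≤ 1 / m := by
  rw [norm_div, Complex.norm_real, Real.norm_eq_abs]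
  have h1 : |1 - t ^ 2| ≤ 1 := by
    rw [abs_le]; constructor <;> nlinarith [ht.1, ht.2]
  calc |1 - t ^ 2| / ‖1 - 2 * (t : ℂ) * z + (t : ℂ) ^ 2‖ ≤ 1 / ‖1 - 2 * (t : ℂ) * z + (t : ℂ) ^ 2‖ :=
        div_le_div_of_nonneg_right h1 (norm_nonneg _)
    _ ≤ 1 / m := div_le_div_of_nonneg_left zero_le_one hm hmz

/-- **Holomorphy of the Poisson transform** on the slit region `{Im z > 0} ∪ {Re z < 1}`
(dominated holomorphic parameter integral). [folklore] -/
theorem differentiableOn_poissonTransform (μ : Measure ℝ) [IsFiniteMeasure μ]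
    (hμ : μ (Set.Icc (0 : ℝ) 1)ᶜ = 0) :
    DifferentiableOn ℂ (fun z : ℂ => ∫ t, ((1 - t ^ 2 : ℝ) : ℂ) / (1 - 2 * (t : ℂ) * z + (t : ℂ) ^ 2) ∂μ)
      {z : ℂ | 0 < z.im ∨ z.re < 1} := by
  have hae : ∀ᵐ t ∂μ, t ∈ Set.Icc (0 : ℝ) 1 := by
    rw [ae_iff]; simpa only [Set.mem_setOf_eq, ← Set.mem_compl_iff, Set.setOf_mem_eq] using hμ
  apply differentiableOn_integral_of_dominated
  · exact fun z _ => (measurable_poissonIntegrand z).aestronglyMeasurable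
  · filter_upwards [hae] with t ht
    refine DifferentiableOn.div (differentiableOn_const _) (by fun_prop) fun z hz => ?_
    exact poissonDen_ne_zero ht hz
  · intro z₀ hz₀
    obtain ⟨R, m, hR, hm, hballU, hbound⟩ := exists_poissonDen_lower_bound hz₀
    refine ⟨R, hR, hballU, fun _ => 1 / m, integrable_const _, ?_⟩
    filter_upwards [hae] with t ht
    intro z hz
    exact norm_poissonIntegrand_le ht hm (hbound t ht z hz)

/-- Integrability of the integrand at every point of the slit region. [folklore] -/
theorem integrable_poissonIntegrand (μ : Measure ℝ) [IsFiniteMeasure μ]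
    (hμ : μ (Set.Icc (0 : ℝ) 1)ᶜ = 0) {z : ℂ} (hz : 0 < z.im ∨ z.re < 1) :
    Integrable (fun t : ℝ => ((1 - t ^ 2 : ℝ) : ℂ) / (1 - 2 * (t : ℂ) * z + (t : ℂ) ^ 2)) μ := by
  have hae : ∀ᵐ t ∂μ, t ∈ Set.Icc (0 : ℝ) 1 := by
    rw [ae_iff]; simpa only [Set.mem_setOf_eq, ← Set.mem_compl_iff, Set.setOf_mem_eq] using hμ
  obtain ⟨R, m, hR, hm, -, hbound⟩ := exists_poissonDen_lower_bound hz
  refine Integrable.mono' (integrable_const (1 / m)) (measurable_poissonIntegrand z).aestronglyMeasurable ?_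
  filter_upwards [hae] with t ht
  exact norm_poissonIntegrand_le ht hm (hbound t ht z (mem_ball_self hR))

/-- Real and imaginary parts of the integrand: with `D = 1 - 2tz + t²`,
`Re = (1-t²) Re D/|D|²`, `Im = (1-t²)(2t Im z)/|D|²`. [folklore] -/
theorem poissonIntegrand_re_im (t : ℝ) (z : ℂ) :
    (((1 - t ^ 2 : ℝ) : ℂ) / (1 - 2 * (t : ℂ) * z + (t : ℂ) ^ 2)).re =
        (1 - t ^ 2) * (1 - 2 * t * z.re + t ^ 2) / Complex.normSq (1 - 2 * (t : ℂ) * z + (t : ℂ) ^ 2) ∧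
      (((1 - t ^ 2 : ℝ) : ℂ) / (1 - 2 * (t : ℂ) * z + (t : ℂ) ^ 2)).im =
        (1 - t ^ 2) * (2 * t * z.im) / Complex.normSq (1 - 2 * (t : ℂ) * z + (t : ℂ) ^ 2) := by
  obtain ⟨hre, him⟩ := poissonDen_re_im t z
  constructor
  · rw [Complex.div_re, Complex.ofReal_re, Complex.ofReal_im, hre, zero_mul, zero_div, add_zero,
      mul_div_assoc]
  · rw [Complex.div_im, Complex.ofReal_re, Complex.ofReal_im, him, zero_mul, zero_div, zero_sub,
      mul_neg, neg_div, neg_neg, mul_div_assoc]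

/-- **The Poisson transform is real on the real axis**: for real `x`,
`F(x) = ∫ (1 - t²)/(1 - 2tx + t²) dμ(t)` (as a real integral). [folklore] -/
theorem poissonTransform_ofReal (μ : Measure ℝ) (x : ℝ) :
    (∫ t, ((1 - t ^ 2 : ℝ) : ℂ) / (1 - 2 * (t : ℂ) * (x : ℂ) + (t : ℂ) ^ 2) ∂μ) =
      ((∫ t, (1 - t ^ 2) / (1 - 2 * t * x + t ^ 2) ∂μ : ℝ) : ℂ) := by
  have h : (fun t : ℝ => ((1 - t ^ 2 : ℝ) : ℂ) / (1 - 2 * (t : ℂ) * (x : ℂ) + (t : ℂ) ^ 2)) =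
      fun t : ℝ => (((1 - t ^ 2) / (1 - 2 * t * x + t ^ 2) : ℝ) : ℂ) := by
    funext t; push_cast; ring
  rw [h]
  exact _root_.integral_ofReal

/-- **Non-vanishing of the Poisson transform** on the slit region, when `μ` charges `[0, 1)`:
with `K = Re z/Im z` (if `Im z > 0`) or `K = 0` (if `Re z < 1`), `Re F(z) + K Im F(z) > 0`.
[folklore] -/
theorem poissonTransform_ne_zero (μ : Measure ℝ) [IsFiniteMeasure μ]
    (hμ : μ (Set.Icc (0 : ℝ) 1)ᶜ = 0) (hμ0 : μ (Set.Ico (0 : ℝ) 1) ≠ 0) {z : ℂ}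
    (hz : 0 < z.im ∨ z.re < 1) :
    (∫ t, ((1 - t ^ 2 : ℝ) : ℂ) / (1 - 2 * (t : ℂ) * z + (t : ℂ) ^ 2) ∂μ) ≠ 0 := by
  have hae : ∀ᵐ t ∂μ, t ∈ Set.Icc (0 : ℝ) 1 := by
    rw [ae_iff]; simpa only [Set.mem_setOf_eq, ← Set.mem_compl_iff, Set.setOf_mem_eq] using hμ
  set I : ℝ → ℂ := fun t => ((1 - t ^ 2 : ℝ) : ℂ) / (1 - 2 * (t : ℂ) * z + (t : ℂ) ^ 2) with hI
  have hint : Integrable I μ := integrable_poissonIntegrand μ hμ hz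
  -- the weight `K` and the positive numerator `N t = Re D + 2 K t Im z`
  set K : ℝ := if 0 < z.im then z.re / z.im else 0 with hK
  have hN : ∀ t ∈ Set.Icc (0 : ℝ) 1, 0 < 1 - 2 * t * z.re + t ^ 2 + 2 * K * t * z.im := by
    intro t ht
    by_cases him : 0 < z.im
    · rw [hK, if_pos him]
      have : 1 - 2 * t * z.re + t ^ 2 + 2 * (z.re / z.im) * t * z.im = 1 + t ^ 2 := by
        field_simp; ring
      rw [this]; positivity
    · rw [hK, if_neg him]
      have hre : z.re < 1 := hz.resolve_left him
      nlinarith [ht.1, ht.2, mul_nonneg ht.1 (sub_pos.2 hre).le]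
  -- the functional `ψ = Re I + K Im I`
  set ψ : ℝ → ℝ := fun t => (I t).re + K * (I t).im with hψ
  have hψ_eq : ∀ t, ψ t = (1 - t ^ 2) * (1 - 2 * t * z.re + t ^ 2 + 2 * K * t * z.im) /
      Complex.normSq (1 - 2 * (t : ℂ) * z + (t : ℂ) ^ 2) := by
    intro t
    obtain ⟨hre, him⟩ := poissonIntegrand_re_im t z
    simp only [hψ, hI, hre, him]
    ring
  have hψ_nonneg : ∀ t ∈ Set.Icc (0 : ℝ) 1, 0 ≤ ψ t := by
    intro t ht
    rw [hψ_eq]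
    refine div_nonneg (mul_nonneg (by nlinarith [ht.1, ht.2]) (hN t ht).le) (Complex.normSq_nonneg _)
  have hψ_pos : ∀ t ∈ Set.Ico (0 : ℝ) 1, 0 < ψ t := by
    intro t ht
    have ht' : t ∈ Set.Icc (0 : ℝ) 1 := ⟨ht.1, ht.2.le⟩
    rw [hψ_eq]
    refine div_pos (mul_pos (by nlinarith [ht.1, ht.2]) (hN t ht')) ?_
    exact Complex.normSq_pos.mpr (poissonDen_ne_zero ht' hz)
  have h1i : Integrable (fun t => (I t).re) μ := hint.re
  have h2i : Integrable (fun t => K * (I t).im) μ := hint.im.const_mul K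
  have hψ_int : Integrable ψ μ := h1i.add h2i
  have hψ_integral : ∫ t, ψ t ∂μ = (∫ t, I t ∂μ).re + K * (∫ t, I t ∂μ).im := by
    simp only [hψ]
    rw [integral_add h1i h2i, MeasureTheory.integral_const_mul]
    have h1 := integral_re hint
    have h2 := integral_im hint
    simp only [RCLike.re_to_complex, RCLike.im_to_complex] at h1 h2
    rw [h1, h2]
  have hpos : 0 < ∫ t, ψ t ∂μ := by
    rw [integral_pos_iff_support_of_nonneg_ae (hae.mono fun t ht => hψ_nonneg t ht) hψ_int]
    refine lt_of_lt_of_le (pos_iff_ne_zero.mpr hμ0) (measure_mono fun t ht => ?_)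
    exact (hψ_pos t ht).ne'
  intro h0
  rw [hψ_integral] at hpos
  have : (∫ t, I t ∂μ) = 0 := h0
  rw [this] at hpos
  simp at hpos

/-- **`-1/F` is a Pick function**: `F` is holomorphic and non-vanishing on the upper half-plane and
`Im F ≥ 0` there (the imaginary part of the integrand is `(1-t²)(2t Im z)/|D|² ≥ 0`), so
`Im (-1/F) = Im F/|F|² ≥ 0`. [folklore] -/
theorem isPickFunction_neg_inv_poissonTransform (μ : Measure ℝ) [IsFiniteMeasure μ]
    (hμ : μ (Set.Icc (0 : ℝ) 1)ᶜ = 0) (hμ0 : μ (Set.Ico (0 : ℝ) 1) ≠ 0) :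
    IsPickFunction (fun z : ℂ =>
      -(∫ t, ((1 - t ^ 2 : ℝ) : ℂ) / (1 - 2 * (t : ℂ) * z + (t : ℂ) ^ 2) ∂μ)⁻¹) := by
  have hae : ∀ᵐ t ∂μ, t ∈ Set.Icc (0 : ℝ) 1 := by
    rw [ae_iff]; simpa only [Set.mem_setOf_eq, ← Set.mem_compl_iff, Set.setOf_mem_eq] using hμ
  have hsub : UpperHalfPlane.upperHalfPlaneSet ⊆ {z : ℂ | 0 < z.im ∨ z.re < 1} :=
    fun z hz => Or.inl hz
  constructor
  · refine ((differentiableOn_poissonTransform μ hμ).mono hsub).inv (fun z hz => ?_) |>.neg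
    exact poissonTransform_ne_zero μ hμ hμ0 (hsub hz)
  · intro z hz
    have hz' : 0 < z.im := hz
    have hint := integrable_poissonIntegrand μ hμ (Or.inl hz')
    have himF : 0 ≤ (∫ t, ((1 - t ^ 2 : ℝ) : ℂ) / (1 - 2 * (t : ℂ) * z + (t : ℂ) ^ 2) ∂μ).im := by
      have h2 := integral_im hint
      simp only [RCLike.im_to_complex] at h2
      rw [← h2]
      refine integral_nonneg_of_ae (hae.mono fun t ht => ?_)
      show (0 : ℝ) ≤ (((1 - t ^ 2 : ℝ) : ℂ) / (1 - 2 * (t : ℂ) * z + (t : ℂ) ^ 2)).im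
      rw [(poissonIntegrand_re_im t z).2]
      refine div_nonneg (mul_nonneg (by nlinarith [ht.1, ht.2]) ?_) (Complex.normSq_nonneg _)
      exact mul_nonneg (mul_nonneg (by norm_num) ht.1) hz'.le
    rw [Complex.neg_im, Complex.inv_im, neg_div, neg_neg]
    exact div_nonneg himF (Complex.normSq_nonneg _)

/-- **Registered auxiliary stub `stub_pickInversion_auxPick`** (sub-goal of `stub_pickInversion`):
for a finite positive measure `μ` on `[0, 1]` charging `[0, 1)`, the function
`z ↦ -1/∫ (1 - t²)/(1 - 2tz + t²) dμ(t)` is a Pick function. [folklore] -/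
theorem stub_pickInversion_auxPick : ∀ (μ : MeasureTheory.Measure ℝ), MeasureTheory.IsFiniteMeasure μ →
    μ (Set.Icc (0 : ℝ) 1)ᶜ = 0 → μ (Set.Ico (0 : ℝ) 1) ≠ 0 →
    Literature.Analysis.Complex.IsPickFunction (fun z : ℂ =>
      -(∫ t, ((1 - t ^ 2 : ℝ) : ℂ) / (1 - 2 * (t : ℂ) * z + (t : ℂ) ^ 2) ∂μ)⁻¹) :=
  fun μ hfin hμ hμ0 => by
    haveI := hfin
    exact isPickFunction_neg_inv_poissonTransform μ hμ hμ0

end Summit.CriticalPhenomena.Ising3DConformalLimit.Cruxes.DirectCorrelationStableTail.SelfEnergyPickInversion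

end
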